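import Mathlib
import HarnessLib

/-!
# T3b — the lattice lemma: every finitely generated module upstairs is a strict transform

Crux `HomologicalConductor.Persistence` (stmt-ResolutionOfSingularities-16484), chain W4.4b, line `std`
(M-A′), typed target T3b of `L/w44b/PlanSignaturesSTD-v0.3.lean` (`exists_strictTransform_of_torsionFree`,
binders VERBATIM): for `k`-subalgebras `B ≤ C` of a field `K`, every finitely generated `↥C`-module `N`
is generated over `↥C` by an injective `↥B`-semilinear image of a finitely generated `↥B`-module —
namely the `↥B`-span `Y₀ ⊆ N` of a finite `↥C`-generating set, with `φ` the inclusion. (The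
hypotheses `Frac B = K`, `C` noetherian, `N` torsion-free of the typed signature are carried but not
needed.) Consequence recorded by the planner: STD_{t,e} is purely the question WHICH generating
`B`-lattices of high `C`-syzygies are Ω/⊕/retract-equivalent to high `B`-syzygies.
`[OURS · L1 w44b]`; folklore bookkeeping, not a statement of any manuscript.
-/

-- single-problem summit: the doubled namespace component is forced
set_option linter.dupNamespace false

noncomputable section

namespace Summit.ResolutionOfSingularities.ResolutionOfSingularities.Theorems.HomologicalConductor.PersistenceStrictTransformLattice

variable {k K : Type} [Field k] [Field K] [Algebra k K]

/-- **Lattice lemma, general form.** For a ring hom `f : B → C` and a finitely generated `C`-module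
`N`, the `B`-span `Y₀` (via `f`) of a finite `C`-generating set is a finitely generated `B`-module
whose inclusion is injective, `f`-semilinear, and `C`-generates `N`. [folklore] -/
theorem exists_lattice {B C : Type} [CommRing B] [CommRing C] (f : B →+* C) (N : ModuleCat.{0} C)
    [Module.Finite C N] :
    ∃ (Y₀ : ModuleCat.{0} B) (φ : Y₀ →+ N), Module.Finite B Y₀ ∧
      (∀ (b : B) (y : Y₀), φ (b • y) = f b • φ y) ∧
      Function.Injective φ ∧ Submodule.span C (Set.range φ) = ⊤ := by
  classical
  letI : Module B N := Module.compHom N f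
  obtain ⟨S, hS⟩ := Module.Finite.fg_top (R := C) (M := N)
  let Y₀ : Submodule B N := Submodule.span B (S : Set N)
  haveI : Module.Finite B ↥Y₀ := Module.Finite.span_of_finite B S.finite_toSet
  refine ⟨ModuleCat.of B ↥Y₀, Y₀.subtype.toAddMonoidHom, inferInstance, fun b y => rfl,
    Subtype.val_injective, ?_⟩
  rw [eq_top_iff, ← hS]
  refine Submodule.span_le.mpr fun n hn => Submodule.subset_span ?_
  exact ⟨⟨n, Submodule.subset_span hn⟩, rfl⟩

/-- **T3b `exists_strictTransform_of_torsionFree` (PlanSignaturesSTD-v0.3, binders verbatim) — the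
LATTICE LEMMA.** For `k`-subalgebras `B ≤ C` of the field `K`, every finitely generated `↥C`-module
`N` is generated over `↥C` by an injective `↥B`-semilinear (along the inclusion) image of a finitely
generated `↥B`-module `Y₀`: take `Y₀ :=` the `↥B`-span of a finite `↥C`-generating set.
(`Frac B = K`, noetherianity and torsion-freeness are not used.) [folklore] -/
theorem exists_strictTransform_of_torsionFree (B C : Subalgebra k K) (hle : B ≤ C)
    [IsFractionRing ↥B K] [IsNoetherianRing ↥C] (N : ModuleCat.{0} ↥C) [Module.Finite ↥C N]
    [Module.IsTorsionFree ↥C N] :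
    ∃ (Y₀ : ModuleCat.{0} ↥B) (φ : Y₀ →+ N), Module.Finite ↥B Y₀ ∧
      (∀ (b : ↥B) (y : Y₀), φ (b • y) = (Subalgebra.inclusion hle).toRingHom b • φ y) ∧
      Function.Injective φ ∧ Submodule.span ↥C (Set.range φ) = ⊤ :=
  exists_lattice (Subalgebra.inclusion hle).toRingHom N

end Summit.ResolutionOfSingularities.ResolutionOfSingularities.Theorems.HomologicalConductor.PersistenceStrictTransformLattice

end
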